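import Literature.RingTheory.MvPowerSeries.MaximalIdealPow
import Mathlib.RingTheory.AdicCompletion.LocalRing
import Mathlib.RingTheory.LocalRing.ResidueField.Basic
import Mathlib.Data.Fintype.Card
import HarnessLib

/-!
# [OURS · L1 W4.6, rungs (i)/(ii) — the dictionary, SCHEME HALF, brick 16] Residue fields of presented local rings, and
# rationality of points for free over FINITE fields
Cell res-hironaka (LADDER-RESOLUTION rung L, D-0089), slot W4.6, seat res-L1-s46-pv-2 (gen 3). Host: route
`WildCones`, crux `ClassicalRegimes` (stmt-ResolutionOfSingularities-16884), `--supports … --as helper`.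

HONEST FRAMING. Everything here is OURS and pure commutative algebra over Mathlib (`AdicCompletion.residueField_map_bijective`,
`IsLocalRing.ResidueField.map/mapEquiv`, `Finite.injective_iff_surjective_of_equiv`) and the tree
(`Literature.RingTheory.MvPowerSeries.Jets.mem_maximalIdeal_iff_constantCoeff_eq_zero`). NOTHING here is a statement of
H. Hironaka's manuscript [Hironaka2017]; no FACT-LIST premise. AI review is weaker than expert review.

## Why (the only use of «`K` algebraically closed» in the forced-atom rung)

The one step of the forced-atom rung (`ForcedAtom.exists_presentation_transform_of_isBlowup`, p523688) uses the algebraic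
closedness of `K` at exactly one place: the next singular point `ξ′` is RATIONAL over `ξ` («every element of `𝒪_{Z′,ξ′}` is
congruent modulo `𝔪_{ξ′}` to an element coming from `𝒪_{Z,ξ}`», brick 7′). In the forced-atom regime both stalks are
PRESENTED, `𝒪̂ ≃+* K⟦X⟧`, so both residue fields are abstractly isomorphic to `K` (`nonempty_residueField_equiv_of_presentation`);
when `K` is FINITE this forces the residue extension `κ(ξ) ↪ κ(ξ′)` to be bijective (an injection between finite sets of
the same size), i.e. rationality (`exists_sub_map_mem_maximalIdeal_of_finite`) — so the rung holds over every finite field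
too (file `…ForcedAtomFiniteField.lean`). Over an infinite perfect non-closed field this fails in general (a field may be
isomorphic to a proper finite extension of itself), which is why that case stays open.

Contents: `maximalIdeal_eq_ker_constantCoeff`, `residueFieldEquivOfMvPowerSeries`-free statement
`nonempty_residueField_mvPowerSeries_equiv`, `nonempty_residueField_equiv_of_presentation`,
`residueField_map_surjective_of_finite`, `exists_sub_map_mem_maximalIdeal_of_finite`. [folklore]
-/

noncomputable section

-- single-problem summit: the doubled namespace component `ResolutionOfSingularities` is forced
set_option linter.dupNamespace false

open MvPowerSeries IsLocalRing

namespace Summit.ResolutionOfSingularities.ResolutionOfSingularities.Theorems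

namespace CampaignW46.AtomGerm

variable {K : Type} [Field K] {σ : Type}

/-- The maximal ideal of `K⟦X⟧` is the kernel of the constant-coefficient map. [folklore] -/
theorem maximalIdeal_eq_ker_constantCoeff :
    maximalIdeal (MvPowerSeries σ K) = RingHom.ker (constantCoeff : MvPowerSeries σ K →+* K) := by
  ext f
  rw [Literature.RingTheory.MvPowerSeries.Jets.mem_maximalIdeal_iff_constantCoeff_eq_zero, RingHom.mem_ker]

/-- The residue field of `K⟦X⟧` is `K`. [folklore] -/
theorem nonempty_residueField_mvPowerSeries_equiv :
    Nonempty (ResidueField (MvPowerSeries σ K) ≃+* K) :=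
  ⟨(Ideal.quotEquivOfEq (maximalIdeal_eq_ker_constantCoeff (K := K) (σ := σ))).trans
    (RingHom.quotientKerEquivOfSurjective (f := (constantCoeff : MvPowerSeries σ K →+* K))
      fun a => ⟨C a, constantCoeff_C a⟩)⟩

/-- **A presented local ring has residue field `K`**: if the completion of a Noetherian local ring `R` is ring-isomorphic
to a power series ring over the field `K`, then `ResidueField R ≃+* K`. [folklore] -/
theorem nonempty_residueField_equiv_of_presentation {R : Type} [CommRing R] [IsLocalRing R] [IsNoetherianRing R]
    (E₀ : AdicCompletion (maximalIdeal R) R ≃+* MvPowerSeries σ K) : Nonempty (ResidueField R ≃+* K) := by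
  obtain ⟨e⟩ := nonempty_residueField_mvPowerSeries_equiv (K := K) (σ := σ)
  exact ⟨(RingEquiv.ofBijective _ (AdicCompletion.residueField_map_bijective R)).trans
    ((ResidueField.mapEquiv E₀).trans e)⟩

/-- Over a FINITE field, a local homomorphism of local rings whose residue fields are both isomorphic to `K` induces a
SURJECTIVE (hence bijective) map of residue fields: an injection between finite sets of the same size. [folklore] -/
theorem residueField_map_surjective_of_finite [Finite K] {R S : Type} [CommRing R] [IsLocalRing R] [CommRing S]
    [IsLocalRing S] (g : R →+* S) [IsLocalHom g] (eR : ResidueField R ≃+* K) (eS : ResidueField S ≃+* K) :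
    Function.Surjective (ResidueField.map g) := by
  haveI : Finite (ResidueField R) := Finite.of_equiv K eR.symm.toEquiv
  exact (Finite.injective_iff_surjective_of_equiv (eR.toEquiv.trans eS.symm.toEquiv)).mp
    (ResidueField.map g).injective

/-- **Rationality for free over a finite field**: under the hypotheses of `residueField_map_surjective_of_finite`, every
element of `S` is congruent modulo `𝔪_S` to the image of an element of `R`. [folklore] -/
theorem exists_sub_map_mem_maximalIdeal_of_finite [Finite K] {R S : Type} [CommRing R] [IsLocalRing R] [CommRing S]
    [IsLocalRing S] (g : R →+* S) [IsLocalHom g] (eR : ResidueField R ≃+* K) (eS : ResidueField S ≃+* K) (y : S) :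
    ∃ r : R, y - g r ∈ maximalIdeal S := by
  obtain ⟨x, hx⟩ := residueField_map_surjective_of_finite g eR eS (residue S y)
  obtain ⟨r, rfl⟩ := residue_surjective x
  refine ⟨r, ?_⟩
  rw [ResidueField.map_residue] at hx
  rw [← Ideal.Quotient.mk_eq_mk_iff_sub_mem]
  exact hx.symm

end CampaignW46.AtomGerm

end Summit.ResolutionOfSingularities.ResolutionOfSingularities.Theorems

end
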